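import Literature.Topology.FourManifolds.TrisectionsHeegaardStabilize
import HarnessLib

/-!
# Heegaard data of the level with prescribed excess genus

Topic `Literature/Topology/FourManifolds`; for the fact seat
`provefact-Literature.Topology.FourManifolds.exists_isBalancedGKTrisection` (Gay–Kirby 2016,
Thm. 4: *"Stabilize the Heegaard splitting exactly `k₂` times"*, §4, p. 14 of arXiv:1205.1565).
Everything in this file is **proved**; no definitions, no named facts.

`exists_heegaardData_add`: the Heegaard data of `TrisectionsHeegaardData.lean` (an ordered Morse
function `φ` of the level `Y = f⁻¹(a)` in tube form about the attaching circles, with regular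
value `b ∈ (1/2, 1)`, both sides connected handlebodies `♮^{gen} S¹ × B²`, connected Heegaard
surface) can be had with **every genus `gen₀ + s`, `s ∈ ℕ`**, for some `gen₀`: stabilise `s`
times away from the thin tubes (`exists_stabilize`, `TrisectionsHeegaardStabilize.lean`), where
`φ ≤ 3/7 < 1/2 < b`, and repackage (`exists_handles_of_ordered`).  The values clause becomes
`|φ - b| ≤ 1`.

## References

* D. Gay, R. Kirby, *Trisecting 4-manifolds*, Geom. Topol. 20 (2016), §4, proof of Thm. 4 and Lemma 14. [GayKirby2016]
* J. Milnor, *Lectures on the h-cobordism theorem* (1965), Lemma 8.2, Thms. 2.7, 4.8, 8.1. [MilnorHCobordism1965]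
-/

open scoped Manifold ContDiff Topology
open Set Function Filter Metric

noncomputable section

universe u

namespace Literature.Topology.FourManifolds

variable {X : Type u} [TopologicalSpace X] [T2Space X] [SecondCountableTopology X] [CompactSpace X]
  [ChartedSpace (EuclideanSpace ℝ (Fin 4)) X] [IsManifold (𝓡 4) ∞ X]

/-- **The Heegaard data of the level with every genus `gen₀ + s`.** [cite: GayKirby2016, §4, proof of Thm. 4 and Lemma 14] [cite: MilnorHCobordism1965, Lemma 8.2, Thms. 2.7, 4.8, 8.1] -/
theorem exists_heegaardData_add {f : X → ℝ} {a η : ℝ} {ι : Type} [Fintype ι]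
    (TS : TubeSystem f a η ι) (h : IsRegularLevel (𝓡 4) f a) [ConnectedSpace (RegularLevel h)]
    (hηR : 82 * η ≤ TS.R ^ 2) {ε : ℝ} (hε : 0 < ε) (hε1 : ε ≤ 1 / 100) :
    ∃ gen₀ : ℕ, ∀ s : ℕ, ∃ (φ : RegularLevel h → ℝ) (b : ℝ) (hb : IsRegularLevel (𝓡 3) φ b),
      IsMorse (𝓡 3) φ ∧ (∀ y, |φ y - b| ≤ 1) ∧ 1 / 2 < b ∧ b < 1 ∧
      (∀ z, IsMCriticalPt (𝓡 3) φ z → φ z < b → morseIndex (𝓡 3) φ z ≤ 1) ∧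
      (∀ z, IsMCriticalPt (𝓡 3) φ z → b < φ z → 2 ≤ morseIndex (𝓡 3) φ z) ∧
      (∀ j (y : RegularLevel h), y.1 ∈ (TS.chart j).source →
        TubeModel.tube ε (1 / (4 * η)) η (TS.centred j y.1) < 3 →
        φ y = (1 / 7) * TubeModel.tube ε (1 / (4 * η)) η (TS.centred j y.1)) ∧
      HasHandleDecomposition 2 (RegularSublevel hb) (handleCount 1 (gen₀ + s)) ∧
      HasHandleDecomposition 2 (RegularSuperlevel hb) (handleCount 1 (gen₀ + s)) ∧
      (gen₀ + s) + (criticalSetOfIndex (𝓡 3) φ 0 ∩ φ ⁻¹' Iio b).ncard =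
        (criticalSetOfIndex (𝓡 3) φ 1 ∩ φ ⁻¹' Iio b).ncard + 1 ∧
      IsConnected (φ ⁻¹' {b}) ∧ ConnectedSpace (RegularSublevel hb) ∧ ConnectedSpace (RegularSuperlevel hb) := by
  obtain ⟨φ, b, hb, gen₀, hφM, hval, hbhalf, hb1, hbelow, habove, htube, -, -, hgen, hlevel, -, -⟩ :=
    exists_heegaardData TS h hηR hε hε1
  refine ⟨gen₀, fun s => ?_⟩
  -- stabilise `s` times above `3/7`
  set δ : ℝ := min ((b - 1 / 2) / 2) ((1 - b) / 2) with hδ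
  have hδpos : 0 < δ := lt_min (by linarith) (by linarith)
  have hδ1 : δ ≤ (b - 1 / 2) / 2 := min_le_left _ _
  have hδ2 : δ ≤ (1 - b) / 2 := min_le_right _ _
  have hP : ∀ y ∈ {y : RegularLevel h | φ y ≤ 3 / 7}, φ y ≤ 3 / 7 := fun y hy => hy
  obtain ⟨φ', b', hφ', hb', hbb, hφφ, hPeq, hbelow', habove', -, hset0, hcount1⟩ :=
    exists_stabilize hφM hb hbelow habove hlevel.nonempty hP hδpos (by linarith) s
  obtain ⟨gen, hd₁, hd₂, hgen', hlevel', hconn₁, hconn₂⟩ := exists_handles_of_ordered hφ' hb' hbelow' habove'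
  have hgeneq : gen = gen₀ + s := by
    rw [hset0, hcount1] at hgen'
    omega
  subst hgeneq
  rw [abs_lt] at hbb
  refine ⟨φ', b', hb', hφ', fun y => ?_, by linarith [hbb.1], by linarith [hbb.2], hbelow', habove',
    fun j y hys hlt => ?_, hd₁, hd₂, hgen', hlevel', hconn₁, hconn₂⟩
  · -- `|φ' - b'| ≤ 1`
    have h1 := hφφ y
    have h2 := hval y
    rw [abs_lt] at h1
    rw [abs_le]
    constructor <;> linarith [h1.1, h1.2, h2.1, h2.2, hbb.1, hbb.2]
  · -- the tube form is untouched
    have hφy := htube j y hys hlt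
    have hyP : y ∈ {y : RegularLevel h | φ y ≤ 3 / 7} := by
      show φ y ≤ 3 / 7
      rw [hφy]; linarith
    rw [hPeq y hyP, hφy]

end Literature.Topology.FourManifolds

end
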